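import Summits.QuantumFields.YangMills.Theorems.LangevinControlUVFemtoCurvatureTwoPointCDefsProfiles

/-!
# Route `LangevinControlUV`, crux `FemtoCurvatureTwoPointC` (stmt-QuantumFields-16204): vocabulary of line `Sketch`, III — femto boxes vs small tori

Part III of the route-posited statements of the skeleton `Cruxes/FemtoCurvatureTwoPointC/Lines/Sketch.lean` (continuation lead
`prover-line-stmt-QuantumFields-16204-c3-0`, reshape v5; parts I/II are `…CDefs.lean`, `…CDefsProfiles.lean`, same namespace, which
see for the conventions: NOTHING here is asserted; the two `def`s below are line statements consumed by the bridge
`afCouplingAt_of_big_of_small` of the companion file `…FemtoCurvatureTwoPointCSplitBridge.lean`).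

The point of v5. The crux `FemtoCurvatureTwoPointC` quantifies over EVERY femto torus `L` with `L·a(β) ≤ ℓ₀` — including the
tori `2 ≤ L ≤ 7`, on which its axis clause is vacuous (`8n ≤ L` fails) but its PAIR clause is not. Through the reductions this
surfaces in `AFCouplingAt` / `AFProfilesAt` as clauses with a vacuous window hypothesis on `L < 8`: plaquette covariances on the
tori `2 … 7` must be `≤ C·u(8,β)²` — fixed-torus second-order Laplace asymptotics of Wilson's measure on six small lattices,
which has nothing to do with the femto continuum limit an RG / stochastic-control engine addresses (box sizes `L ≥ 8` upward).
v5 separates the two: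

* `AFProfilesBigAt r` — `AFProfilesAt r` with every matching clause restricted to boxes `L ≥ 8`, plus the BARE-SIZE clause
  `c₈ ≤ β·u(8,β)` (`c₈ > 0`: the coupling of the smallest box is at least of bare size `1/β`; for the explicit two-loop witness
  `β·u(8,β) → 1/κ`). This is the femto-engine statement proper.
* `SmallTorusVarianceLawAt r` — on the tori `2 ≤ L ≤ 7`, `Var_{L,β}(P_0^{01}) ≤ K/β²` eventually: the bare-coupling law of the
  plaquette variance on six fixed finite lattices (finite-dimensional Laplace asymptotics near the flat variety; for EVEN `L` the
  tree has it conditionally via `GenericStepGammaEncoding.PlaquetteVarianceEven` ← chessboard ← doubling ←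
  `Literature…WilsonPartitionRegularVariation`; odd `L ∈ {3,5,7}` is the open core `DiagUpperRestOdd` of stmt-9363's line).

By the landed Cauchy–Schwarz ceiling `FemtoCurvatureTwoPoint.abs_plaquetteCov_le_plaquetteVar_rep` (`|Cov(P_x^{ij},P_y^{i'j'})| ≤
Var(P_0^{01})` on every torus) the small-torus pair clause needs nothing but this variance law (`dist ≤ 7`), and
`K/β² ≤ (K/c₈²)·u(8,β)²` converts it to the coupling's units. Refs: `Cruxes/FemtoCurvatureTwoPointC/NOTES.md` (cycle 5).
-/

set_option autoImplicit false

noncomputable section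

open Filter Topology MeasureTheory
open Literature.MathematicalPhysics.QuantumFieldTheory

namespace Summit.QuantumFields.YangMills.Theorems.FemtoCurvatureTwoPointC

/-- **AF profiles on femto BOXES (`L ≥ 8`) at fixed data `(G, r)` — the femto-engine statement of line `Sketch` after
reshape v5 (OPEN; crux-sized).** Exactly `AFProfilesAt r` (admissibility, in-window comparability, the two-sided averaged dyadic
asymptotic-freedom step law; transverse lower `c·u(8n,β)² ≤ n⁸ f_L(n)` for `1 ≤ n`, `8n ≤ L`; transverse upper
`s⁸ f_L(s) ≤ C·u(max 8 (min L (8s)),β)²` and longitudinal upper `s⁸ |g_L(s)| ≤ C·u(…)²` for `1 ≤ s`, `2s ≤ L`; variance ceiling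
`Var_{L,β}(P_0^{01}) ≤ C·u(8,β)²`) EXCEPT that the four matching clauses are demanded only on window boxes with `8 ≤ L`, and ONE
clause is added: BARE SIZE `c₈ ≤ β·u(8,β)` for `β ≥ β₀` (`c₈ > 0`). Window of box `L`: every sub-box `8 ≤ M ≤ L` has
`u M β ≤ u₀`. Content: Bałaban-class ultraviolet stability WITH a dimension-8 observable along femto trajectories — not in print. -/
def AFProfilesBigAt {G : Type} [Group G] [TopologicalSpace G] [IsTopologicalGroup G] [CompactSpace G]
    [MeasurableSpace G] [BorelSpace G] (r : LatticeRep G) : Prop :=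
  ∃ (u : ℕ → ℝ → ℝ) (u₀ β₀ κ₁ κ₂ κ₃ c C c₈ : ℝ),
    0 < u₀ ∧ 0 < c ∧ 0 < κ₁ ∧ 0 ≤ κ₃ ∧ 0 < c₈ ∧
    (∀ (L : ℕ) (β : ℝ), 8 ≤ L → β₀ ≤ β → 0 < u L β) ∧
    (∀ L : ℕ, 8 ≤ L → ContinuousOn (u L) (Set.Ici β₀)) ∧
    (∀ L : ℕ, 8 ≤ L → Filter.Tendsto (u L) Filter.atTop (nhds 0)) ∧
    (∀ β : ℝ, β₀ ≤ β → c₈ ≤ β * u 8 β) ∧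
    (∀ (L L' : ℕ) (β : ℝ), β₀ ≤ β → 8 ≤ L → L ≤ L' → L' ≤ 2 * L →
        (∀ M : ℕ, 8 ≤ M → M ≤ L → u M β ≤ u₀) → |(u L β)⁻¹ - (u L' β)⁻¹| ≤ κ₂) ∧
    (∀ (k m : ℕ) (β : ℝ), β₀ ≤ β → (∀ M : ℕ, 8 ≤ M → M ≤ 8 * 2 ^ (k + m) → u M β ≤ u₀) →
        κ₁ * m - κ₃ ≤ (u (8 * 2 ^ k) β)⁻¹ - (u (8 * 2 ^ (k + m)) β)⁻¹ ∧
          (u (8 * 2 ^ k) β)⁻¹ - (u (8 * 2 ^ (k + m)) β)⁻¹ ≤ κ₂ * m + κ₃) ∧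
    (∀ (L : ℕ) [NeZero L] (β : ℝ) (n : ℕ), β₀ ≤ β → 1 ≤ n → 8 * n ≤ L →
        (∀ M : ℕ, 8 ≤ M → M ≤ L → u M β ≤ u₀) →
        ∀ (P : (Fin 4 → ZMod L) → Fin 4 → Fin 4 → GaugeConfig 4 L G → ℝ)
          (E : (GaugeConfig 4 L G → ℝ) → ℝ),
          (P = fun x i j U => (r.N : ℝ) - (r.ρ (plaquetteHolonomy U x i j)).trace.re) →
          (E = fun F => wilsonExpectation r.ρ β F) →
          c * u (8 * n) β ^ 2 ≤
            (n : ℝ) ^ 8 * (E (fun U => P 0 0 1 U * P (Pi.single (2 : Fin 4) ((n : ℕ) : ZMod L)) 0 1 U)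
              - E (P 0 0 1) * E (P (Pi.single (2 : Fin 4) ((n : ℕ) : ZMod L)) 0 1))) ∧
    (∀ (L : ℕ) [NeZero L] (β : ℝ) (s : ℕ), β₀ ≤ β → 8 ≤ L → 1 ≤ s → 2 * s ≤ L →
        (∀ M : ℕ, 8 ≤ M → M ≤ L → u M β ≤ u₀) →
        ∀ (P : (Fin 4 → ZMod L) → Fin 4 → Fin 4 → GaugeConfig 4 L G → ℝ)
          (E : (GaugeConfig 4 L G → ℝ) → ℝ),
          (P = fun x i j U => (r.N : ℝ) - (r.ρ (plaquetteHolonomy U x i j)).trace.re) →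
          (E = fun F => wilsonExpectation r.ρ β F) →
          (s : ℝ) ^ 8 * (E (fun U => P 0 0 1 U * P (Pi.single (2 : Fin 4) ((s : ℕ) : ZMod L)) 0 1 U)
              - E (P 0 0 1) * E (P (Pi.single (2 : Fin 4) ((s : ℕ) : ZMod L)) 0 1)) ≤
            C * u (max 8 (min L (8 * s))) β ^ 2) ∧
    (∀ (L : ℕ) [NeZero L] (β : ℝ) (s : ℕ), β₀ ≤ β → 8 ≤ L → 1 ≤ s → 2 * s ≤ L →
        (∀ M : ℕ, 8 ≤ M → M ≤ L → u M β ≤ u₀) →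
        ∀ (P : (Fin 4 → ZMod L) → Fin 4 → Fin 4 → GaugeConfig 4 L G → ℝ)
          (E : (GaugeConfig 4 L G → ℝ) → ℝ),
          (P = fun x i j U => (r.N : ℝ) - (r.ρ (plaquetteHolonomy U x i j)).trace.re) →
          (E = fun F => wilsonExpectation r.ρ β F) →
          (s : ℝ) ^ 8 * |E (fun U => P 0 0 1 U * P (Pi.single (0 : Fin 4) ((s : ℕ) : ZMod L)) 0 1 U)
              - E (P 0 0 1) * E (P (Pi.single (0 : Fin 4) ((s : ℕ) : ZMod L)) 0 1)| ≤
            C * u (max 8 (min L (8 * s))) β ^ 2) ∧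
    (∀ (L : ℕ) [NeZero L] (β : ℝ), β₀ ≤ β → 8 ≤ L → (∀ M : ℕ, 8 ≤ M → M ≤ L → u M β ≤ u₀) →
        ∀ (P : (Fin 4 → ZMod L) → Fin 4 → Fin 4 → GaugeConfig 4 L G → ℝ)
          (E : (GaugeConfig 4 L G → ℝ) → ℝ),
          (P = fun x i j U => (r.N : ℝ) - (r.ρ (plaquetteHolonomy U x i j)).trace.re) →
          (E = fun F => wilsonExpectation r.ρ β F) →
          E (fun U => P 0 0 1 U * P 0 0 1 U) - E (P 0 0 1) * E (P 0 0 1) ≤ C * u 8 β ^ 2)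

/-- **AF profiles on femto boxes (universal closure)**: for every compact simple `G` (any Borel structure) and faithful unitary
`r`, `AFProfilesBigAt r`. Registered stub `stub_afProfilesBig` of line `Sketch` (skeleton v5), by name
(`afProfilesBig_iff_stub`). OPEN — the femto continuum limit with a dimension-8 observable, boxes `L ≥ 8` only. -/
def AFProfilesBig : Prop :=
  ∀ (G : Type) [Group G] [TopologicalSpace G] [IsTopologicalGroup G] [CompactSpace G]
    [MeasurableSpace G] [BorelSpace G], IsCompactSimpleLieGroup G →
    ∀ r : LatticeRep G, AFProfilesBigAt r

/-- **Small-torus variance law at fixed data `(G, r)` (OPEN; finite-dimensional).** On each of the six tori `2 ≤ L ≤ 7` the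
plaquette variance obeys the bare-coupling law `Var_{L,β}(P_0^{01}) ≤ K/β²` for `β ≥ β₀` (one `K`, one `β₀`). Second-order
Laplace asymptotics of Wilson's measure on a fixed finite lattice near the (singular) variety of flat connections; for even `L`
conditionally in the tree (`GenericStepGammaEncoding.PlaquetteVarianceEven` via chessboard estimates and the doubling bound from
`WilsonPartitionRegularVariation`), for `L ∈ {3, 5, 7}` the open core of stmt-9363's `DiagUpperRestOdd`. By the Cauchy–Schwarz
ceiling `FemtoCurvatureTwoPoint.abs_plaquetteCov_le_plaquetteVar_rep` it controls every plaquette covariance on these tori. -/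
def SmallTorusVarianceLawAt {G : Type} [Group G] [TopologicalSpace G] [IsTopologicalGroup G] [CompactSpace G]
    [MeasurableSpace G] [BorelSpace G] (r : LatticeRep G) : Prop :=
  ∃ (K β₀ : ℝ), ∀ (L : ℕ) [NeZero L] (β : ℝ), 2 ≤ L → L < 8 → β₀ ≤ β →
    ∀ (P : (Fin 4 → ZMod L) → Fin 4 → Fin 4 → GaugeConfig 4 L G → ℝ)
      (E : (GaugeConfig 4 L G → ℝ) → ℝ),
      (P = fun x i j U => (r.N : ℝ) - (r.ρ (plaquetteHolonomy U x i j)).trace.re) →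
      (E = fun F => wilsonExpectation r.ρ β F) →
      E (fun U => P 0 0 1 U * P 0 0 1 U) - E (P 0 0 1) * E (P 0 0 1) ≤ K / β ^ 2

/-- **Small-torus variance law (universal closure)**: for every compact simple `G` (any Borel structure) and faithful unitary
`r`, `SmallTorusVarianceLawAt r`. Registered stub `stub_smallTorusVariance` of line `Sketch` (skeleton v5), by name
(`smallTorusVarianceLaw_iff_stub`). OPEN (finite-dimensional; six lattices). -/
def SmallTorusVarianceLaw : Prop :=
  ∀ (G : Type) [Group G] [TopologicalSpace G] [IsTopologicalGroup G] [CompactSpace G]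
    [MeasurableSpace G] [BorelSpace G], IsCompactSimpleLieGroup G →
    ∀ r : LatticeRep G, SmallTorusVarianceLawAt r

/-- `AFProfilesBig` is, definitionally, the registered stub signature of `stub_afProfilesBig` (line `Sketch`, skeleton v5,
crux stmt-QuantumFields-16204). -/
theorem afProfilesBig_iff_stub :
    AFProfilesBig ↔
      ∀ (G : Type) [Group G] [TopologicalSpace G] [IsTopologicalGroup G] [CompactSpace G]
        [MeasurableSpace G] [BorelSpace G], IsCompactSimpleLieGroup G →
        ∀ r : LatticeRep G, ∃ (u : ℕ → ℝ → ℝ) (u₀ β₀ κ₁ κ₂ κ₃ c C c₈ : ℝ),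
          0 < u₀ ∧ 0 < c ∧ 0 < κ₁ ∧ 0 ≤ κ₃ ∧ 0 < c₈ ∧
          (∀ (L : ℕ) (β : ℝ), 8 ≤ L → β₀ ≤ β → 0 < u L β) ∧
          (∀ L : ℕ, 8 ≤ L → ContinuousOn (u L) (Set.Ici β₀)) ∧
          (∀ L : ℕ, 8 ≤ L → Filter.Tendsto (u L) Filter.atTop (nhds 0)) ∧
          (∀ β : ℝ, β₀ ≤ β → c₈ ≤ β * u 8 β) ∧
          (∀ (L L' : ℕ) (β : ℝ), β₀ ≤ β → 8 ≤ L → L ≤ L' → L' ≤ 2 * L →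
              (∀ M : ℕ, 8 ≤ M → M ≤ L → u M β ≤ u₀) → |(u L β)⁻¹ - (u L' β)⁻¹| ≤ κ₂) ∧
          (∀ (k m : ℕ) (β : ℝ), β₀ ≤ β → (∀ M : ℕ, 8 ≤ M → M ≤ 8 * 2 ^ (k + m) → u M β ≤ u₀) →
              κ₁ * m - κ₃ ≤ (u (8 * 2 ^ k) β)⁻¹ - (u (8 * 2 ^ (k + m)) β)⁻¹ ∧
                (u (8 * 2 ^ k) β)⁻¹ - (u (8 * 2 ^ (k + m)) β)⁻¹ ≤ κ₂ * m + κ₃) ∧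
          (∀ (L : ℕ) [NeZero L] (β : ℝ) (n : ℕ), β₀ ≤ β → 1 ≤ n → 8 * n ≤ L →
              (∀ M : ℕ, 8 ≤ M → M ≤ L → u M β ≤ u₀) →
              ∀ (P : (Fin 4 → ZMod L) → Fin 4 → Fin 4 → GaugeConfig 4 L G → ℝ)
                (E : (GaugeConfig 4 L G → ℝ) → ℝ),
                (P = fun x i j U => (r.N : ℝ) - (r.ρ (plaquetteHolonomy U x i j)).trace.re) →
                (E = fun F => wilsonExpectation r.ρ β F) →
                c * u (8 * n) β ^ 2 ≤
                  (n : ℝ) ^ 8 * (E (fun U => P 0 0 1 U * P (Pi.single (2 : Fin 4) ((n : ℕ) : ZMod L)) 0 1 U)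
                    - E (P 0 0 1) * E (P (Pi.single (2 : Fin 4) ((n : ℕ) : ZMod L)) 0 1))) ∧
          (∀ (L : ℕ) [NeZero L] (β : ℝ) (s : ℕ), β₀ ≤ β → 8 ≤ L → 1 ≤ s → 2 * s ≤ L →
              (∀ M : ℕ, 8 ≤ M → M ≤ L → u M β ≤ u₀) →
              ∀ (P : (Fin 4 → ZMod L) → Fin 4 → Fin 4 → GaugeConfig 4 L G → ℝ)
                (E : (GaugeConfig 4 L G → ℝ) → ℝ),
                (P = fun x i j U => (r.N : ℝ) - (r.ρ (plaquetteHolonomy U x i j)).trace.re) →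
                (E = fun F => wilsonExpectation r.ρ β F) →
                (s : ℝ) ^ 8 * (E (fun U => P 0 0 1 U * P (Pi.single (2 : Fin 4) ((s : ℕ) : ZMod L)) 0 1 U)
                    - E (P 0 0 1) * E (P (Pi.single (2 : Fin 4) ((s : ℕ) : ZMod L)) 0 1)) ≤
                  C * u (max 8 (min L (8 * s))) β ^ 2) ∧
          (∀ (L : ℕ) [NeZero L] (β : ℝ) (s : ℕ), β₀ ≤ β → 8 ≤ L → 1 ≤ s → 2 * s ≤ L →
              (∀ M : ℕ, 8 ≤ M → M ≤ L → u M β ≤ u₀) →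
              ∀ (P : (Fin 4 → ZMod L) → Fin 4 → Fin 4 → GaugeConfig 4 L G → ℝ)
                (E : (GaugeConfig 4 L G → ℝ) → ℝ),
                (P = fun x i j U => (r.N : ℝ) - (r.ρ (plaquetteHolonomy U x i j)).trace.re) →
                (E = fun F => wilsonExpectation r.ρ β F) →
                (s : ℝ) ^ 8 * |E (fun U => P 0 0 1 U * P (Pi.single (0 : Fin 4) ((s : ℕ) : ZMod L)) 0 1 U)
                    - E (P 0 0 1) * E (P (Pi.single (0 : Fin 4) ((s : ℕ) : ZMod L)) 0 1)| ≤
                  C * u (max 8 (min L (8 * s))) β ^ 2) ∧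
          (∀ (L : ℕ) [NeZero L] (β : ℝ), β₀ ≤ β → 8 ≤ L → (∀ M : ℕ, 8 ≤ M → M ≤ L → u M β ≤ u₀) →
              ∀ (P : (Fin 4 → ZMod L) → Fin 4 → Fin 4 → GaugeConfig 4 L G → ℝ)
                (E : (GaugeConfig 4 L G → ℝ) → ℝ),
                (P = fun x i j U => (r.N : ℝ) - (r.ρ (plaquetteHolonomy U x i j)).trace.re) →
                (E = fun F => wilsonExpectation r.ρ β F) →
                E (fun U => P 0 0 1 U * P 0 0 1 U) - E (P 0 0 1) * E (P 0 0 1) ≤ C * u 8 β ^ 2) :=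
  Iff.rfl

/-- `SmallTorusVarianceLaw` is, definitionally, the registered stub signature of `stub_smallTorusVariance` (line `Sketch`,
skeleton v5, crux stmt-QuantumFields-16204). -/
theorem smallTorusVarianceLaw_iff_stub :
    SmallTorusVarianceLaw ↔
      ∀ (G : Type) [Group G] [TopologicalSpace G] [IsTopologicalGroup G] [CompactSpace G]
        [MeasurableSpace G] [BorelSpace G], IsCompactSimpleLieGroup G →
        ∀ r : LatticeRep G, ∃ (K β₀ : ℝ), ∀ (L : ℕ) [NeZero L] (β : ℝ), 2 ≤ L → L < 8 → β₀ ≤ β →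
          ∀ (P : (Fin 4 → ZMod L) → Fin 4 → Fin 4 → GaugeConfig 4 L G → ℝ)
            (E : (GaugeConfig 4 L G → ℝ) → ℝ),
            (P = fun x i j U => (r.N : ℝ) - (r.ρ (plaquetteHolonomy U x i j)).trace.re) →
            (E = fun F => wilsonExpectation r.ρ β F) →
            E (fun U => P 0 0 1 U * P 0 0 1 U) - E (P 0 0 1) * E (P 0 0 1) ≤ K / β ^ 2 :=
  Iff.rfl

end Summit.QuantumFields.YangMills.Theorems.FemtoCurvatureTwoPointC

end
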